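import Summits.ABC.ABC.Theses.DefiniteXi
import Literature.NumberTheory.EllipticCurves.HeegnerPointsModularityProofs
import Literature.NumberTheory.EllipticCurves.Szpiro
import HarnessLib

/-!
# Route DefiniteXi, item `FreyModularity` (stmt-ABC-11340): the exact residual of the item

`FreyModularity` — every Frey curve `E_(a,b) = freyCurve a b` (`a`, `b` coprime, `ab(a+b) ≠ 0`)
carries a `ModularParametrizationData` at its conductor level — is the Modularity Theorem for Frey
curves in datum form (Wiles 1995; Breuil–Conrad–Diamond–Taylor 2001, Thm. A; level = conductor by
Carayol 1986).  `DefiniteXiFreyModularity.lean` derives it from the tree's named fact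
`nonempty_modularParametrizationData` (model transport, unconditional).  This file records, at the
level of the item itself, *exactly* what is left once the analytic halves of the datum — the
Néron-type lattice (`exists_isNeronLatticeOf_holds`, AEC VI.5.1), the uniformisation
`ℂ →+ E(ℂ)` (`IsNeronLatticeOf.exists_uniformize_holds`, AEC VI.3.6(b)) and the modular degree
(`exists_modularDegree_holds`) — are theorems of the tree:

* `freyModularity_iff_forall_exists_isNewformOf` — `FreyModularity` is **equivalent** to: for
  every Frey curve, at its conductor level `N`, there is a newform `f ∈ S₂(Γ₀(N))` with
  `aₙ(f) = aₙ(E_(a,b))` (Modularity "Version `a_p`", BCDT Thm. A (2), for Frey curves) together with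
  a Néron-type period pair `L` of the Frey model and an integer `c ≠ 0` with `c Λ_f ⊆ Λ_L`
  (Eichler–Shimura + Faltings: commensurability of `Λ_f` and `Λ_E`).  Per curve this is the tree's
  `ModularParametrizationData.nonempty_iff_exists_isNewformOf`.
* `forall_exists_isNewformOf_freyCurve_of_freyModularity` — in particular the item implies
  modularity in the form (2) for every Frey curve: nothing weaker than Modularity of Frey curves
  closes it.

## References

* C. Breuil, B. Conrad, F. Diamond, R. Taylor, *On the modularity of elliptic curves over `ℚ`:
  wild 3-adic exercises*, J. Amer. Math. Soc. 14 (2001), 843–939, Thm. A and p. 845 (2), (6).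
* A. Wiles, *Modular elliptic curves and Fermat's Last Theorem*, Ann. of Math. 141 (1995).
* H. Carayol, *Sur les représentations ℓ-adiques associées aux formes modulaires de Hilbert*,
  Ann. Sci. ÉNS 19 (1986).
-/

-- `Summit.<Summit>.<Problem>` is the mandated summit-side namespace (CONVENTIONS §2); for the
-- single-conjunct summit `ABC` the two coincide, so the duplicate `ABC.ABC` is deliberate.
set_option linter.dupNamespace false

noncomputable section

open scoped MatrixGroups ModularForm

open CongruenceSubgroup
open Literature.NumberTheory.EllipticCurves
open Literature.NumberTheory.EllipticCurves.ModularForms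

namespace Summit.ABC.ABC.Theorems

/-- **The exact residual of `FreyModularity`.**  `FreyModularity` holds iff for all coprime
`a, b` with `ab(a+b) ≠ 0` and `N = N_{E_(a,b)}` there are a newform `f ∈ S₂(Γ₀(N))` of the Frey
model (`IsNewformOf (freyCurve a b) f`: Modularity, BCDT 2001 Thm. A in the form (2), with
Carayol's level), a period pair `L` with `g₂(L) = c₄/12`, `g₃(L) = c₆/216` for the Frey model, and
an integer `c ≠ 0` with `c Λ_f ⊆ Λ_L` (Eichler–Shimura with Faltings' isogeny theorem).  The
uniformisation, the lattice and the degree fields of the datum are supplied by theorems of the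
tree (per curve: `ModularParametrizationData.nonempty_iff_exists_isNewformOf`); the Frey model is
elliptic by `isElliptic_freyCurve`. [cite: BCDTJAMS2001, Thm. A with (2), (6) of p. 845] -/
theorem freyModularity_iff_forall_exists_isNewformOf :
    Summit.ABC.ABC.Theses.DefiniteXi.FreyModularity ↔
      ∀ a b : ℤ, IsCoprime a b → a * b * (a + b) ≠ 0 → ∀ (N : ℕ) [NeZero N],
        (freyCurve a b).conductorNorm ℤ = N →
          ∃ f : CuspForm (Gamma0 N) 2, IsNewformOf (freyCurve a b) f ∧ ∃ L : PeriodPair,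
            IsNeronLatticeOf ((freyCurve a b).baseChange ℂ) L ∧
              ∃ c : ℤ, c ≠ 0 ∧ ∀ z ∈ periodLattice f, (c : ℂ) * z ∈ L.lattice := by
  unfold Summit.ABC.ABC.Theses.DefiniteXi.FreyModularity
  refine forall₂_congr fun a b ↦ forall_congr' fun _ ↦ forall_congr' fun h0 ↦
    forall₂_congr fun N _ ↦ forall_congr' fun _ ↦ ?_
  haveI := isElliptic_freyCurve h0
  exact ModularParametrizationData.nonempty_iff_exists_isNewformOf

/-- **`FreyModularity` implies Modularity "Version `a_p`" for every Frey curve**: if every Frey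
curve carries a parametrisation datum at its conductor level, then every Frey curve `E_(a,b)` has a
newform `f ∈ S₂(Γ₀(N_E))` with `aₙ(f) = aₙ(E_(a,b))` for all `n` (the datum's own `f`).  So the item
is not closable by anything weaker than the Modularity Theorem for Frey curves
(Wiles 1995 / BCDT 2001 Thm. A restricted to the curves `y² = x(x − a)(x + b)`).
[cite: BCDTJAMS2001, Thm. A] -/
theorem forall_exists_isNewformOf_freyCurve_of_freyModularity
    (h : Summit.ABC.ABC.Theses.DefiniteXi.FreyModularity) :
    ∀ a b : ℤ, IsCoprime a b → a * b * (a + b) ≠ 0 → ∀ (N : ℕ) [NeZero N],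
      (freyCurve a b).conductorNorm ℤ = N →
        ∃ f : CuspForm (Gamma0 N) 2, IsNewformOf (freyCurve a b) f :=
  fun a b hab h0 N _ hN ↦
    let ⟨f, hf, _⟩ := freyModularity_iff_forall_exists_isNewformOf.mp h a b hab h0 N hN
    ⟨f, hf⟩

end Summit.ABC.ABC.Theorems

end
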